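import Mathlib
import HarnessLib

/-!
# The linear-level caricature of the axis scenario is exactly solvable: Lagrangian law, co-moving source, sign algebra

Kernel-checked cores behind the soloist's (PL13) (HOME `paper/sharpest.md` §5.2, claim C40), closing the stagnation-point
anatomy of `SoloBlindHouLiDefect.lean` (PL7–PL10), `SoloBlindConeMoment.lean` (PL11) and `SoloBlindConeTransport.lean` (PL12).

Setting (informal; the theorems certify only the statements they display). In the `ℝ⁵ = ℝ⁴ × ℝ` picture of axisymmetric
flow (`ρ = |y'|`; Hou–Li variables `u₁ = u_θ/r`, `ω₁ = ω_θ/r`, `ψ₁`, CPAM 61 (2008) eqs. (13)–(16)) the CARICATURE used in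
(PL12) consists of: the linear stagnation conveyor `b = σ₀(−ρ/2, z)` with strain time `τ = ∫σ₀ dt` (flow map
`(ρ₀, z₀) ↦ (ρ₀e^{−τ/2}, z₀e^{τ})`), inviscid swirl transport `D_t u₁ = 2ψ₁,z u₁ = σ₀u₁`, and the vorticity law
`D_t ω₁ = ∂_z(u₁²)` (values carried, sourced by the swirl). It is EXACTLY SOLVABLE: `u₁(τ) = e^{τ} u₁⁰(ρe^{τ/2}, ze^{−τ})`, the
source `∂_z(u₁²)(τ) = e^{τ} S⁰(ρe^{τ/2}, ze^{−τ})` with `S⁰ = ∂_z(u₁⁰)²` CO-MOVES with the conveyor, so every birth at a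
Lagrangian label lands on the same parcel and `ω₁(τ) = ω₁⁰(ρe^{τ/2}, ze^{−τ}) + A(τ) S⁰(ρe^{τ/2}, ze^{−τ})`,
`A' = e^{τ}/σ₀`. Consequently the point functionals of (PL11) evaluated on the generated field — the strain `σ₀ = 2ψ_z(0)` and
the takeover coefficient `σ₂ = 2ψ_zzz(0)`, `ψ = (−Δ₅)⁻¹ω₁` — are `A(τ)` times SHAPE FUNCTIONS of the dilated initial source
pattern along the one-parameter orbit `α = (δ/L)e^{3τ/2}` (aspect ratio height/radius of the swirl layer): nothing dynamic is
left to decide. For the `z`-periodic source pattern `e^{−sρ²} sin(kz)` (Hou's odd class) the heat-kernel representation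
`ψ(0,·) = ∫₀^∞ e^{tΔ₅}ω₁ dt`, `e^{tΔ₄}[e^{−s|y'|²}](0) = (1 + 4st)⁻²`, `e^{t∂²} sin(kz) = e^{−k²t} sin(kz)` gives
`σ₀ = 2k·J`, `σ₂ = −2k³·J` with `J(s,k) = ∫₀^∞ (1 + 4st)⁻² e^{−k²t} dt`; the one sign-definite statement of (PL13) is `J > 0`
(strain fed, and maximal at the stagnation point along the axis, at every strain time and aspect ratio), certified below from
Lebesgue integration. For the `z`-localised waist family `G(ζ) = (g₀ + ζ²)e^{−ζ²/2}` the sign of `σ₂` along the orbit starts as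
`−2h₁/α` (`h₁ = 2g₀(2 − g₀)`: favourable iff a waist, `0 < g₀ < 2`) and ends as `3(h₃ − h₁)/α³` with
`h₃ − h₁ = 2(g₀² − 4g₀ + 2)` (adverse at late strain times iff `g₀ < 2 − √2`); tables in HOME `work/c40_caricature/`.

Content:
* `caricature_label_law` — along a conveyor parcel the generated vorticity obeys `dω/dτ = e^{τ}S⁰/σ₀` and is
  `ω⁰ + (e^{τ} − 1)S⁰/σ₀` (the Duhamel collapse in Lagrangian form);
* `coMoving_source` — for a separable transported swirl `u = e^{τ}U(ρe^{τ/2})G(ze^{−τ})` the source `∂_z(u²)` at the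
  parcel `(ρ₀e^{−τ/2}, z₀e^{τ})` equals `e^{τ}·[U(ρ₀)²·2G(z₀)G'(z₀)]` (chain rule);
* `periodicWeight_integrableOn`, `periodicWeight_pos`, `caricature_periodic_signs` — `J(s,k) > 0`, hence `σ₂ < 0 < σ₀` for the
  periodic class;
* `waistFamily_lateCoeff`, `waistFamily_lateCoeff_neg_iff`, `waistFamily_earlyCoeff_pos_iff` — the sign algebra of the
  two asymptotic laws.

The linter option `linter.dupNamespace` is disabled because the mandated landing namespace repeats the summit name by
design (D-0017). [problem: ns]
-/

set_option linter.dupNamespace false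

open Real MeasureTheory Set

namespace Summit.NavierStokesRegularity.NavierStokesRegularity.Theorems

section Lagrangian

/-- DUHAMEL COLLAPSE ALONG A LABEL. On the conveyor parcel with label `(ρ₀, z₀)` the source seen by the parcel is
`e^{τ} S⁰(ρ₀, z₀)` (co-moving pattern, amplitude `e^{τ}`), so with constant strain `σ₀ ≠ 0` the generated vorticity
`ω(τ) = ω⁰ + (e^{τ} − 1) S⁰/σ₀` solves `dω/dτ = e^{τ} S⁰/σ₀` with `ω(0) = ω⁰`. -/
theorem caricature_label_law (ω₀ S₀ σ₀ τ : ℝ) :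
    HasDerivAt (fun τ' : ℝ => ω₀ + (Real.exp τ' - 1) * S₀ / σ₀) (Real.exp τ * S₀ / σ₀) τ ∧
      (ω₀ + (Real.exp 0 - 1) * S₀ / σ₀ = ω₀) := by
  refine ⟨?_, by simp⟩
  have h : HasDerivAt (fun τ' : ℝ => Real.exp τ' - 1) (Real.exp τ) τ := by
    simpa using (Real.hasDerivAt_exp τ).sub_const 1
  have h2 := (h.mul_const S₀).div_const σ₀
  simpa using h2.const_add ω₀

/-- CO-MOVING SOURCE (chain rule). Let the transported swirl be `u(ρ, z) = e^{τ}·U(ρe^{τ/2})·G(ze^{−τ})` at strain time `τ`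
(separable datum `u⁰ = U ⊗ G` carried by the dilation and spun up by `e^{τ}`). If `G` has derivative `g` at `z₀`, then
`z ↦ u(ρ₀e^{−τ/2}, z)²` has derivative `e^{τ}·(U(ρ₀)²·(2·G(z₀)·g))` at the parcel height `z = z₀e^{τ}`: the source pattern
`S⁰ = U²·(G²)'` is seen dilated and amplified by exactly `e^{τ}`. -/
theorem coMoving_source (U G : ℝ → ℝ) (g ρ₀ z₀ τ : ℝ) (hG : HasDerivAt G g z₀) :
    HasDerivAt (fun z : ℝ => (Real.exp τ * U (ρ₀ * Real.exp (-τ / 2) * Real.exp (τ / 2)) * G (z * Real.exp (-τ))) ^ 2)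
      (Real.exp τ * (U ρ₀ ^ 2 * (2 * G z₀ * g))) (z₀ * Real.exp τ) := by
  have hρ : ρ₀ * Real.exp (-τ / 2) * Real.exp (τ / 2) = ρ₀ := by
    rw [mul_assoc, ← Real.exp_add]
    have h0 : -τ / 2 + τ / 2 = 0 := by ring
    rw [h0, Real.exp_zero, mul_one]
  have hee : Real.exp τ * Real.exp (-τ) = 1 := by
    rw [← Real.exp_add, add_neg_cancel, Real.exp_zero]
  have hz : z₀ * Real.exp τ * Real.exp (-τ) = z₀ := by rw [mul_assoc, hee, mul_one]
  have hGz : G (z₀ * Real.exp τ * Real.exp (-τ)) = G z₀ := congrArg G hz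
  -- inner map z ↦ z e^{-τ} has derivative e^{-τ}; at z₀ e^{τ} it lands on z₀
  have hlin : HasDerivAt (fun z : ℝ => z * Real.exp (-τ)) (Real.exp (-τ)) (z₀ * Real.exp τ) := by
    simpa using (hasDerivAt_id (z₀ * Real.exp τ)).mul_const (Real.exp (-τ))
  have hG' : HasDerivAt G g (z₀ * Real.exp τ * Real.exp (-τ)) := by rw [hz]; exact hG
  have hcomp : HasDerivAt (fun z : ℝ => G (z * Real.exp (-τ))) (g * Real.exp (-τ)) (z₀ * Real.exp τ) :=
    hG'.comp (z₀ * Real.exp τ) hlin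
  have hu : HasDerivAt (fun z : ℝ => Real.exp τ * U ρ₀ * G (z * Real.exp (-τ)))
      (Real.exp τ * U ρ₀ * (g * Real.exp (-τ))) (z₀ * Real.exp τ) := hcomp.const_mul _
  have h2 := hu.mul hu
  rw [hρ]
  have hfun : (fun z : ℝ => (Real.exp τ * U ρ₀ * G (z * Real.exp (-τ))) ^ 2)
      = fun z => Real.exp τ * U ρ₀ * G (z * Real.exp (-τ)) * (Real.exp τ * U ρ₀ * G (z * Real.exp (-τ))) := by
    funext z; ring
  rw [hfun]
  refine h2.congr_deriv ?_
  linear_combination (2 * Real.exp τ * U ρ₀ ^ 2 * g * G (z₀ * Real.exp τ * Real.exp (-τ))) * hee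
    + (2 * Real.exp τ * U ρ₀ ^ 2 * g) * hGz

end Lagrangian

section PeriodicClass

/-- The heat-kernel weight of the periodic class, `t ↦ (1 + 4st)⁻² e^{−k²t}`, is integrable on `(0, ∞)` for `s ≥ 0`,
`k ≠ 0` (dominated by `e^{−k²t}`). -/
theorem periodicWeight_integrableOn (s k : ℝ) (hs : 0 ≤ s) (hk : k ≠ 0) :
    IntegrableOn (fun t : ℝ => ((1 + 4 * s * t) ^ 2)⁻¹ * Real.exp (-(k ^ 2) * t)) (Ioi 0) := by
  have hk2 : 0 < k ^ 2 := by positivity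
  have hexp : IntegrableOn (fun t : ℝ => Real.exp (-(k ^ 2) * t)) (Ioi 0) := exp_neg_integrableOn_Ioi 0 hk2
  refine hexp.mono' ?_ ?_
  · refine ContinuousOn.aestronglyMeasurable ?_ measurableSet_Ioi
    refine ContinuousOn.mul ?_ (by fun_prop)
    refine ContinuousOn.inv₀ (by fun_prop) ?_
    intro t ht
    have ht' : 0 < t := ht
    positivity
  · refine (ae_restrict_iff' measurableSet_Ioi).2 (Filter.Eventually.of_forall ?_)
    intro t ht
    have ht' : 0 < t := ht
    have h1 : 1 ≤ (1 + 4 * s * t) ^ 2 := by nlinarith [mul_nonneg hs ht'.le]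
    have hinv : ((1 + 4 * s * t) ^ 2)⁻¹ ≤ 1 := inv_le_one_of_one_le₀ h1
    have hinv0 : 0 ≤ ((1 + 4 * s * t) ^ 2)⁻¹ := by positivity
    rw [Real.norm_eq_abs, abs_of_nonneg (mul_nonneg hinv0 (Real.exp_pos _).le)]
    calc ((1 + 4 * s * t) ^ 2)⁻¹ * Real.exp (-(k ^ 2) * t)
        ≤ 1 * Real.exp (-(k ^ 2) * t) := by gcongr
      _ = Real.exp (-(k ^ 2) * t) := one_mul _

/-- `J(s,k) = ∫₀^∞ (1 + 4st)⁻² e^{−k²t} dt > 0` for `s ≥ 0`, `k ≠ 0`: the integrand is positive on `(0, ∞)`, a set of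
infinite (in particular positive) Lebesgue measure. -/
theorem periodicWeight_pos (s k : ℝ) (hs : 0 ≤ s) (hk : k ≠ 0) :
    0 < ∫ t in Ioi (0 : ℝ), ((1 + 4 * s * t) ^ 2)⁻¹ * Real.exp (-(k ^ 2) * t) := by
  have hint := periodicWeight_integrableOn s k hs hk
  have hpos : ∀ t ∈ Ioi (0 : ℝ), 0 < ((1 + 4 * s * t) ^ 2)⁻¹ * Real.exp (-(k ^ 2) * t) := by
    intro t ht
    have ht' : 0 < t := ht
    have : 0 < 1 + 4 * s * t := by positivity
    positivity
  rw [setIntegral_pos_iff_support_of_nonneg_ae ?_ hint]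
  · have hsub : Ioi (0 : ℝ) ⊆
        Function.support (fun t : ℝ => ((1 + 4 * s * t) ^ 2)⁻¹ * Real.exp (-(k ^ 2) * t)) ∩ Ioi 0 :=
      fun t ht => ⟨(hpos t ht).ne', ht⟩
    calc (0 : ENNReal) < volume (Ioi (0 : ℝ)) := by simp
      _ ≤ _ := measure_mono hsub
  · exact (ae_restrict_iff' measurableSet_Ioi).2 (Filter.Eventually.of_forall fun t ht => (hpos t ht).le)

/-- SIGNS FOR THE PERIODIC CLASS. With `J = J(s,k)` as above and `k > 0`, the generated pattern `e^{−sρ²} sin(kz)` has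
`σ₂ = −2k³J < 0` (axial strain maximal at the stagnation point along the axis: takeover-favourable) and `σ₀ = 2kJ > 0`
(the generated layer feeds the stagnation-point stretching), for every wavenumber and radial width. -/
theorem caricature_periodic_signs (s k : ℝ) (hs : 0 ≤ s) (hk : 0 < k) :
    -2 * k ^ 3 * (∫ t in Ioi (0 : ℝ), ((1 + 4 * s * t) ^ 2)⁻¹ * Real.exp (-(k ^ 2) * t)) < 0 ∧
      0 < 2 * k * (∫ t in Ioi (0 : ℝ), ((1 + 4 * s * t) ^ 2)⁻¹ * Real.exp (-(k ^ 2) * t)) := by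
  have hJ := periodicWeight_pos s k hs hk.ne'
  constructor
  · have : 0 < 2 * k ^ 3 * (∫ t in Ioi (0 : ℝ), ((1 + 4 * s * t) ^ 2)⁻¹ * Real.exp (-(k ^ 2) * t)) := by positivity
    linarith
  · positivity

end PeriodicClass

section WaistFamily

/-- LATE-TIME COEFFICIENT of the waist family `G(ζ) = (g₀ + ζ²)e^{−ζ²/2}`: with `h₁ = 2g₀(2 − g₀)` and `h₃ = 4(1 − g₀)` (the
`ζ` and `ζ³` coefficients of `(G²)'·e^{ζ²}`), `σ₂ ∼ 3(h₃ − h₁)/α³` along the orbit and `h₃ − h₁ = 2(g₀² − 4g₀ + 2)`. -/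
theorem waistFamily_lateCoeff (g₀ : ℝ) :
    4 * (1 - g₀) - 2 * g₀ * (2 - g₀) = 2 * (g₀ ^ 2 - 4 * g₀ + 2) := by
  ring

/-- The late-time coefficient is NEGATIVE (favourable: strain maximal at the stagnation point) exactly for
`2 − √2 < g₀ < 2 + √2`; for waists (`g₀ < 2`) this reads `g₀ > 2 − √2 ≈ 0.586`, i.e. plane value at least
`(g₀/2)e^{1 − g₀/2} ≈ 59 %` of the swirl maximum; deeper waists and the node (`g₀ = 0`) end adverse. -/
theorem waistFamily_lateCoeff_neg_iff (g₀ : ℝ) :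
    g₀ ^ 2 - 4 * g₀ + 2 < 0 ↔ 2 - Real.sqrt 2 < g₀ ∧ g₀ < 2 + Real.sqrt 2 := by
  have hs : Real.sqrt 2 ^ 2 = 2 := Real.sq_sqrt (by norm_num)
  have hs0 : 0 < Real.sqrt 2 := Real.sqrt_pos.mpr (by norm_num)
  have key : g₀ ^ 2 - 4 * g₀ + 2 = (g₀ - 2) ^ 2 - Real.sqrt 2 ^ 2 := by rw [hs]; ring
  constructor
  · intro h
    rw [key] at h
    have habs : |g₀ - 2| < Real.sqrt 2 := by
      have h' : (g₀ - 2) ^ 2 < Real.sqrt 2 ^ 2 := by linarith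
      exact abs_lt_of_sq_lt_sq' h' hs0.le |>.elim (fun h1 h2 => abs_lt.mpr ⟨by linarith, by linarith⟩)
    rcases abs_lt.mp habs with ⟨h1, h2⟩
    constructor <;> linarith
  · rintro ⟨h1, h2⟩
    rw [key]
    have : (g₀ - 2) ^ 2 < Real.sqrt 2 ^ 2 := by
      have habs : |g₀ - 2| < Real.sqrt 2 := abs_lt.mpr ⟨by linarith, by linarith⟩
      have := sq_lt_sq' (by linarith [abs_lt.mp habs]) (by linarith [abs_lt.mp habs] : g₀ - 2 < Real.sqrt 2)
      simpa using this
    linarith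

/-- EARLY-TIME COEFFICIENT: `σ₂ ∼ −2h₁/α` as `α → 0` (the one-dimensional stratified layer, `σ₂ = −2ω₁,z(0,0)`), with
`h₁ = 2g₀(2 − g₀)`; it is favourable (`h₁ > 0`) exactly for a waist, `0 < g₀ < 2`. -/
theorem waistFamily_earlyCoeff_pos_iff (g₀ : ℝ) :
    0 < 2 * g₀ * (2 - g₀) ↔ 0 < g₀ ∧ g₀ < 2 := by
  constructor
  · intro h
    by_contra hc
    rw [not_and_or] at hc
    rcases hc with h1 | h2
    · push Not at h1
      have : 2 * g₀ * (2 - g₀) ≤ 0 := by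
        rcases lt_or_ge g₀ 2 with h3 | h3
        · nlinarith
        · nlinarith
      linarith
    · push Not at h2
      rcases lt_or_ge g₀ 0 with h3 | h3
      · nlinarith
      · nlinarith
  · rintro ⟨h1, h2⟩
    have : 0 < 2 - g₀ := by linarith
    positivity

end WaistFamily

end Summit.NavierStokesRegularity.NavierStokesRegularity.Theorems
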